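import Summits.QuantumFields.YangMills.Theorems.FluctuationComparisonRegPrIntLS2BetaRelativeStokes
import Summits.QuantumFields.YangMills.Theorems.FluctuationComparisonRegPrIntLS2BetaCoupledWordSquare
import Summits.QuantumFields.YangMills.Theorems.AlphaInputsT3ACv3AbelianLocal
import HarnessLib

/-!
# S2β · letter (D)∕(D♮) of GAP♯∘, the (C)-half (UV3-NODE §75.3 «RELATIVE key lemma», px10 lineage) — BRICK 2:
# THE RELATIVE MAIN TERM — THE MEMBER MEAN OF THE RELATIVE SQUARE LOOPS IS px12's TENT KERNEL APPLIED TO THE RELATIVE PLAQUETTE FUNCTION (constant ONE),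
# PLUS `2θ ×` THE BLOCK MEAN OF THE COMB DEVIATIONS (a LOCAL bond-deviation datum)

Cell `ym3-torus` (rung R3 = continuum `SU(2)` Yang–Mills on the three-torus — NOT d = 4, NOT infinite volume, NOT a mass gap, NOT Clay).
Width seat «width 10» `ym3-torus-px10` (gen 23), FREE px helper on crux `stmt-QuantumFields-20520` (`Theses.UnitScaleTilt.FluctuationComparisonRegPrIntL`),
count-neutral, DEFINITION-FREE; own-risk brick of the px10 lane «(C)-half of letter (D)» (px16 g21 «GO BRICK 1» 11:28:01Z; ★★OWNER g45 RULING №88: the letters of record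
are the GAUGED letters (D♮) «∃ residual w, `N⁻²·d²(U, w•U₀) ≤ C_D·REL(U; w•U₀)`» ∕ (F♮)).

WHAT.  BRICK 1 (✓`…S2BetaRelativeStokes`) bounds the relative `L × L` square loop `dist1 (U₀(∂□_L(x))⁻¹·U(∂□_L(x)))` by the `L²` relative fine plaquettes, constant ONE, plus
`2θ·(L·Σ_{rows} dev + L²·Σ_{spine} dev)` (`dev b := dist1 (bdev U U₀ b) = dist1 (U₀(b)⁻¹U(b))`, `θ` a bound on the fine plaquettes of `U`).  The (C)-STEP's MAIN TERM
(✓`…S2BetaCoupledWordSquare` §3) is the MEMBER MEAN over `i ∈ Idx` of the square loops at the corners `x_{r(i)} = Site.blockSite y r(i)`; its relative twin is therefore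
(★★★ `mean_dist1_rect_rel_le_tentKernel`):
`|Idx|⁻¹·Σ_i dist1 ((rect U₀ x_{r(i)} μ ν L L)⁻¹·rect U x_{r(i)} μ ν L L) ≤ Σ_p K y p·δ_p + 2θ·(L^d)⁻¹·Σ_{x ∈ B(y)} (L·Σ_{a,b<L} dev⟨x + a e_μ + b e_ν, μ⟩ + L²·Σ_{b<L} dev⟨x + b e_ν, ν⟩)`
with px12 g23's one-level tent kernel `K` written out VERBATIM (✓`sum_tentKernel_mul_eq`, ✓`mean_idx_eq_mean_block` reused, not retyped), `δ_p := dist1 ((U₀∂p)⁻¹·U∂p)`.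
§2 prices the comb term by a LOCAL bond datum: every comb bond is based in one of the `2^d` blocks `z` with `z_κ ∈ {y_κ, y_κ + 1}` (`comb_row_near`, `comb_spine_near`, from
✓`AbelianEML.blockOf_shiftN_eq_or` (file `AlphaInputsT3ACv3AbelianLocal`)), so `dev ≤ α` there gives (★★★ `mean_dist1_rect_rel_le_tentKernel_of_local`)
`… ≤ Σ_p K y p·δ_p + 4·L³·θ·α` — the `hstep` SHAPE of ✓`…KeyLemmaSkeleton.keyLemma_level` for the relative square loops, junk = (global plaquette SIZE `θ`) × (local ARC `α`).

WHY (the road, not proved here).  This is the Stokes∕kernel layer of the RELATIVE (C)-step.  What it does NOT contain: (i) the passage from the relative COARSE plaquette of the full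
(0.4) average `Ū = avgFun ℰ U` to the member mean (the (C)-STEP's loop form ✓G9 + hybrid∕coupling letters ✓G10∕✓G14∕✓G6 are ABSOLUTE bounds `≤ C·τ·τ_loc`; their relative
edition must be LIPSCHITZ in the member loops so that it vanishes at `U = U₀` — the named gap of this lane); (ii) the `ℓ²` Schur count of the comb kernel (row sum `2L³`, bounded
column sum) — routine, next to the assembly.

HONEST SCOPE.  Finite sums over landed identities + BRICK 1; no analysis; nothing of Bałaban's renormalisation analysis is asserted; the relative key lemma, (D♮), (F♮), `hIrr`∕`hA`,
GAP♯∘ (`stub_uniformFibreGapOrbit`), S2β, crux 20520 and `YM3TorusSU2` are NOT proved; no registered stub is closed; the Yang–Mills mass gap is NOT proved.  Sorry-free, axioms standard.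
References: T. Bałaban, CMP **109** (1987) 249–301 [Balaban1987RG1] ((0.3)–(0.4) pp.252–253); CMP **98** (1985) 17–51 [Balaban1985Averaging] ((19) p.21).
-/

set_option autoImplicit false

noncomputable section

namespace Summit.QuantumFields.YangMills.Theorems.FluctuationComparisonRegPrIntLS2BetaRelativeTentKernel

open Finset
open scoped BigOperators
open Literature.MathematicalPhysics.QuantumFieldTheory.Balaban1983to89
open Literature.MathematicalPhysics.QuantumFieldTheory.Balaban1983to89.BlockAveraging (Idx)
open Literature.MathematicalPhysics.QuantumFieldTheory.Balaban1983to89.T4TiltOscillation (bdev)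
open B10Eq47AxialChi (shiftN shiftN_zero shiftN_succ rect)
open Summit.QuantumFields.YangMills.Theorems.FluctuationComparisonRegPrIntLS2BetaRelativeStokes (dist1_rect_rel_le_sum_square)
open Summit.QuantumFields.YangMills.Theorems.FluctuationComparisonRegPrIntLS2BetaCoupledWordSquare (mean_idx_eq_mean_block sum_tentKernel_mul_eq)
open Summit.QuantumFields.YangMills.Theorems.AbelianEML (blockOf_shiftN_eq_or)

variable {P : Params} {j : ℕ} {G : Type*} [GaugeGroup G]

/-! ## §1 The relative main term: tent kernel on `δ_p`, plus the block mean of the comb deviations -/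

/-- ★★★ **THE RELATIVE MAIN TERM, square form** (standing range; any `GaugeGroup` with the commutator letter; `dist1 U(∂p) ≤ θ`): the member MEAN of the relative sharp square loops of the
coarse plaquette `Q = ⟨y; μ, ν⟩` is bounded by px12 g23's tent kernel applied to the relative plaquette function `δ_p = dist1 ((U₀∂p)⁻¹·U∂p)`, constant ONE, plus `2θ ×` the block mean of
the comb deviations: `|Idx|⁻¹·Σ_i δ(□_L(x_{r(i)})) ≤ Σ_p K y p·δ_p + 2θ·(L^d)⁻¹·Σ_{x ∈ B(y)} (L·Σ_{a,b<L} dev⟨x + a e_μ + b e_ν, μ⟩ + L²·Σ_{b<L} dev⟨x + b e_ν, ν⟩)`.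
[cite: Balaban1985Averaging, (19) p.21] -/
theorem mean_dist1_rect_rel_le_tentKernel (hcomm : ∀ g h : G, dist1 (g * h * g⁻¹ * h⁻¹) ≤ 2 * dist1 g * dist1 h)
    (hj : j + 1 ≤ P.m + P.K) (U U₀ : GaugeField P j G) {θ : ℝ} (hθ0 : 0 ≤ θ) (hU : ∀ p : Plaq P j, dist1 (GaugeField.plaqHol U p) ≤ θ)
    (Q : Plaq P (j + 1)) :
    ((Fintype.card (Idx P) : ℝ))⁻¹ * ∑ i : Idx P,
        dist1 ((rect U₀ (Site.blockSite Q.src i.1) Q.μ Q.ν P.L P.L)⁻¹ * rect U (Site.blockSite Q.src i.1) Q.μ Q.ν P.L P.L) ≤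
      ∑ p : Plaq P j, ((P.L : ℝ) ^ P.d)⁻¹ * (((block Q.src).filter (fun x : Site P j => p.μ = Q.μ ∧ p.ν = Q.ν ∧
          ∃ a ∈ range P.L, ∃ b ∈ range P.L, p.src = shiftN (shiftN x Q.μ a) Q.ν b)).card : ℝ) *
          dist1 ((GaugeField.plaqHol U₀ p)⁻¹ * GaugeField.plaqHol U p) +
        2 * θ * (((P.L : ℝ) ^ P.d)⁻¹ * ∑ x ∈ block Q.src,
          ((P.L : ℝ) * ∑ a ∈ range P.L, ∑ b ∈ range P.L, dist1 (bdev U U₀ ⟨shiftN (shiftN x Q.μ a) Q.ν b, Q.μ⟩) +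
            (P.L : ℝ) ^ 2 * ∑ b ∈ range P.L, dist1 (bdev U U₀ ⟨shiftN x Q.ν b, Q.ν⟩))) := by
  rw [mean_idx_eq_mean_block hj Q.src
      (fun x => dist1 ((rect U₀ x Q.μ Q.ν P.L P.L)⁻¹ * rect U x Q.μ Q.ν P.L P.L)),
    sum_tentKernel_mul_eq hj Q.src Q.hμν]
  have hLd : 0 ≤ ((P.L : ℝ) ^ P.d)⁻¹ := inv_nonneg.mpr (pow_nonneg (Nat.cast_nonneg _) _)
  have hsq := fun x => dist1_rect_rel_le_sum_square hcomm U U₀ hθ0 hU x Q.hμν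
  calc ((P.L : ℝ) ^ P.d)⁻¹ * ∑ x ∈ block Q.src, dist1 ((rect U₀ x Q.μ Q.ν P.L P.L)⁻¹ * rect U x Q.μ Q.ν P.L P.L)
      ≤ ((P.L : ℝ) ^ P.d)⁻¹ * ∑ x ∈ block Q.src,
          (∑ a ∈ range P.L, ∑ b ∈ range P.L,
              dist1 ((GaugeField.plaqHol U₀ ⟨shiftN (shiftN x Q.μ a) Q.ν b, Q.μ, Q.ν, Q.hμν⟩)⁻¹ *
                GaugeField.plaqHol U ⟨shiftN (shiftN x Q.μ a) Q.ν b, Q.μ, Q.ν, Q.hμν⟩) +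
            2 * θ * ((P.L : ℝ) * ∑ a ∈ range P.L, ∑ b ∈ range P.L, dist1 (bdev U U₀ ⟨shiftN (shiftN x Q.μ a) Q.ν b, Q.μ⟩) +
              (P.L : ℝ) ^ 2 * ∑ b ∈ range P.L, dist1 (bdev U U₀ ⟨shiftN x Q.ν b, Q.ν⟩))) :=
        mul_le_mul_of_nonneg_left (Finset.sum_le_sum fun x _ => hsq x) hLd
    _ = _ := by rw [Finset.sum_add_distrib, mul_add, ← Finset.mul_sum, mul_left_comm]

/-! ## §2 The comb bonds are based in the `2^d` blocks `z` with `z_κ ∈ {y_κ, y_κ + 1}`; the local-sup form -/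

/-- A coarse unit shift moves one coordinate by `+1` and fixes the others. [folklore] -/
theorem shift_apply_eq_or (y : Site P (j + 1)) (μ κ : Fin P.d) : y.shift μ κ = y κ ∨ y.shift μ κ = y κ + 1 := by
  by_cases h : κ = μ
  · subst h; right; simp [Site.shift]
  · left; simp [Site.shift, h]

/-- ★ **ROW BONDS OF THE COMB ARE NEAR**: for `x ∈ B(y)`, `μ ≠ ν` and `a, b < L` the site `x + a e_μ + b e_ν` lies in a block `z` with `z_κ = y_κ ∨ z_κ = y_κ + 1` for every `κ`
(✓`blockOf_shiftN_eq_or` twice). [cite: Balaban1987RG1, (0.1) p.252] -/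
theorem comb_row_near (hj : j + 1 ≤ P.m + P.K) {y : Site P (j + 1)} {x : Site P j} (hx : x ∈ block y) {μ ν : Fin P.d} (hμν : μ ≠ ν)
    {a b : ℕ} (ha : a < P.L) (hb : b < P.L) :
    ∀ κ, blockOf (shiftN (shiftN x μ a) ν b) κ = y κ ∨ blockOf (shiftN (shiftN x μ a) ν b) κ = y κ + 1 := by
  have hxy : blockOf x = y := (Finset.mem_filter.mp hx).2
  intro κ
  rcases blockOf_shiftN_eq_or hj (shiftN x μ a) ν hb with h2 | h2 <;>
    rcases blockOf_shiftN_eq_or hj x μ ha with h1 | h1 <;> rw [h2]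
  · rw [h1, hxy]; exact Or.inl rfl
  · rw [h1, hxy]; exact shift_apply_eq_or y μ κ
  · rw [h1, hxy]; exact shift_apply_eq_or y ν κ
  · rw [h1, hxy]
    by_cases hκν : κ = ν
    · subst hκν
      right; simp [Site.shift, hμν.symm]
    · by_cases hκμ : κ = μ
      · subst hκμ; right; simp [Site.shift, Function.update_apply, hκν]
      · left; simp [Site.shift, Function.update_apply, hκμ, hκν]

/-- ★ **SPINE BONDS OF THE COMB ARE NEAR**: for `x ∈ B(y)` and `b < L` the site `x + b e_ν` lies in a block `z` with `z_κ = y_κ ∨ z_κ = y_κ + 1`. [cite: Balaban1987RG1, (0.1) p.252] -/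
theorem comb_spine_near (hj : j + 1 ≤ P.m + P.K) {y : Site P (j + 1)} {x : Site P j} (hx : x ∈ block y) (ν : Fin P.d) {b : ℕ} (hb : b < P.L) :
    ∀ κ, blockOf (shiftN x ν b) κ = y κ ∨ blockOf (shiftN x ν b) κ = y κ + 1 := by
  have hxy : blockOf x = y := (Finset.mem_filter.mp hx).2
  intro κ
  rcases blockOf_shiftN_eq_or hj x ν hb with h1 | h1 <;> rw [h1, hxy]
  · exact Or.inl rfl
  · exact shift_apply_eq_or y ν κ

/-- ★★★ **THE RELATIVE MAIN TERM WITH A LOCAL ARC DATUM — the `hstep` SHAPE** (standing range; `dist1 U(∂p) ≤ θ`; `dist1 (bdev U U₀ c) ≤ α` for every bond `c` based in a block `z` with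
`z_κ ∈ {y_κ, y_κ + 1}`): `|Idx|⁻¹·Σ_i δ(□_L(x_{r(i)})) ≤ Σ_p K y p·δ_p + 4·L³·θ·α` — MAIN TERM = px12's tent kernel on the relative plaquette function (constant ONE), JUNK = (global
plaquette SIZE `θ`) × (local bond-deviation ARC `α`) × `4L³` (comb of `L·L² + L²·L` bond slots per corner). [cite: Balaban1985Averaging, (19) p.21] -/
theorem mean_dist1_rect_rel_le_tentKernel_of_local (hcomm : ∀ g h : G, dist1 (g * h * g⁻¹ * h⁻¹) ≤ 2 * dist1 g * dist1 h)
    (hj : j + 1 ≤ P.m + P.K) (U U₀ : GaugeField P j G) {θ : ℝ} (hθ0 : 0 ≤ θ) (hU : ∀ p : Plaq P j, dist1 (GaugeField.plaqHol U p) ≤ θ)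
    (Q : Plaq P (j + 1)) {α : ℝ}
    (hloc : ∀ c : PBond P j, (∀ κ, blockOf c.src κ = Q.src κ ∨ blockOf c.src κ = Q.src κ + 1) → dist1 (bdev U U₀ c) ≤ α) :
    ((Fintype.card (Idx P) : ℝ))⁻¹ * ∑ i : Idx P,
        dist1 ((rect U₀ (Site.blockSite Q.src i.1) Q.μ Q.ν P.L P.L)⁻¹ * rect U (Site.blockSite Q.src i.1) Q.μ Q.ν P.L P.L) ≤
      ∑ p : Plaq P j, ((P.L : ℝ) ^ P.d)⁻¹ * (((block Q.src).filter (fun x : Site P j => p.μ = Q.μ ∧ p.ν = Q.ν ∧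
          ∃ a ∈ range P.L, ∃ b ∈ range P.L, p.src = shiftN (shiftN x Q.μ a) Q.ν b)).card : ℝ) *
          dist1 ((GaugeField.plaqHol U₀ p)⁻¹ * GaugeField.plaqHol U p) +
        4 * (P.L : ℝ) ^ 3 * θ * α := by
  refine (mean_dist1_rect_rel_le_tentKernel hcomm hj U U₀ hθ0 hU Q).trans (add_le_add le_rfl ?_)
  have hL0 : (0 : ℝ) ≤ P.L := Nat.cast_nonneg _
  have hLpos : (0 : ℝ) < (P.L : ℝ) ^ P.d := pow_pos (Nat.cast_pos.mpr P.L_pos) _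
  -- per corner: the comb sum is at most `L·L²·α + L²·L·α = 2L³α`
  have hx : ∀ x ∈ block Q.src,
      (P.L : ℝ) * ∑ a ∈ range P.L, ∑ b ∈ range P.L, dist1 (bdev U U₀ ⟨shiftN (shiftN x Q.μ a) Q.ν b, Q.μ⟩) +
        (P.L : ℝ) ^ 2 * ∑ b ∈ range P.L, dist1 (bdev U U₀ ⟨shiftN x Q.ν b, Q.ν⟩) ≤ 2 * (P.L : ℝ) ^ 3 * α := by
    intro x hxB
    have h1 : ∑ a ∈ range P.L, ∑ b ∈ range P.L, dist1 (bdev U U₀ ⟨shiftN (shiftN x Q.μ a) Q.ν b, Q.μ⟩) ≤ (P.L : ℝ) * ((P.L : ℝ) * α) := by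
      have : ∀ a ∈ range P.L, ∑ b ∈ range P.L, dist1 (bdev U U₀ ⟨shiftN (shiftN x Q.μ a) Q.ν b, Q.μ⟩) ≤ (P.L : ℝ) * α := by
        intro a ha
        have hb : ∀ b ∈ range P.L, dist1 (bdev U U₀ ⟨shiftN (shiftN x Q.μ a) Q.ν b, Q.μ⟩) ≤ α := fun b hb =>
          hloc _ (comb_row_near hj hxB Q.hμν.ne (Finset.mem_range.mp ha) (Finset.mem_range.mp hb))
        calc ∑ b ∈ range P.L, dist1 (bdev U U₀ ⟨shiftN (shiftN x Q.μ a) Q.ν b, Q.μ⟩) ≤ ∑ _b ∈ range P.L, α := Finset.sum_le_sum hb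
          _ = (P.L : ℝ) * α := by rw [Finset.sum_const, Finset.card_range, nsmul_eq_mul]
      calc ∑ a ∈ range P.L, ∑ b ∈ range P.L, dist1 (bdev U U₀ ⟨shiftN (shiftN x Q.μ a) Q.ν b, Q.μ⟩) ≤ ∑ _a ∈ range P.L, (P.L : ℝ) * α :=
            Finset.sum_le_sum this
        _ = (P.L : ℝ) * ((P.L : ℝ) * α) := by rw [Finset.sum_const, Finset.card_range, nsmul_eq_mul]
    have h2 : ∑ b ∈ range P.L, dist1 (bdev U U₀ ⟨shiftN x Q.ν b, Q.ν⟩) ≤ (P.L : ℝ) * α := by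
      have hb : ∀ b ∈ range P.L, dist1 (bdev U U₀ ⟨shiftN x Q.ν b, Q.ν⟩) ≤ α := fun b hb =>
        hloc _ (comb_spine_near hj hxB Q.ν (Finset.mem_range.mp hb))
      calc ∑ b ∈ range P.L, dist1 (bdev U U₀ ⟨shiftN x Q.ν b, Q.ν⟩) ≤ ∑ _b ∈ range P.L, α := Finset.sum_le_sum hb
        _ = (P.L : ℝ) * α := by rw [Finset.sum_const, Finset.card_range, nsmul_eq_mul]
    calc (P.L : ℝ) * ∑ a ∈ range P.L, ∑ b ∈ range P.L, dist1 (bdev U U₀ ⟨shiftN (shiftN x Q.μ a) Q.ν b, Q.μ⟩) +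
          (P.L : ℝ) ^ 2 * ∑ b ∈ range P.L, dist1 (bdev U U₀ ⟨shiftN x Q.ν b, Q.ν⟩)
        ≤ (P.L : ℝ) * ((P.L : ℝ) * ((P.L : ℝ) * α)) + (P.L : ℝ) ^ 2 * ((P.L : ℝ) * α) :=
          add_le_add (mul_le_mul_of_nonneg_left h1 hL0) (mul_le_mul_of_nonneg_left h2 (sq_nonneg _))
      _ = 2 * (P.L : ℝ) ^ 3 * α := by ring
  -- block mean of a quantity `≤ 2L³α` over the `L^d` sites of `B(y)`
  have hcard : ((block Q.src).card : ℝ) = (P.L : ℝ) ^ P.d := by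
    rw [Site.card_block hj]; push_cast; ring
  calc 2 * θ * (((P.L : ℝ) ^ P.d)⁻¹ * ∑ x ∈ block Q.src,
        ((P.L : ℝ) * ∑ a ∈ range P.L, ∑ b ∈ range P.L, dist1 (bdev U U₀ ⟨shiftN (shiftN x Q.μ a) Q.ν b, Q.μ⟩) +
          (P.L : ℝ) ^ 2 * ∑ b ∈ range P.L, dist1 (bdev U U₀ ⟨shiftN x Q.ν b, Q.ν⟩)))
      ≤ 2 * θ * (((P.L : ℝ) ^ P.d)⁻¹ * ∑ _x ∈ block Q.src, 2 * (P.L : ℝ) ^ 3 * α) :=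
        mul_le_mul_of_nonneg_left (mul_le_mul_of_nonneg_left (Finset.sum_le_sum hx) (inv_nonneg.mpr hLpos.le)) (mul_nonneg zero_le_two hθ0)
    _ = 4 * (P.L : ℝ) ^ 3 * θ * α := by
        rw [Finset.sum_const, nsmul_eq_mul, hcard]
        field_simp
        ring

end Summit.QuantumFields.YangMills.Theorems.FluctuationComparisonRegPrIntLS2BetaRelativeTentKernel

end
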